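import Mathlib
import Literature.NumberTheory.Sieve.MontgomeryVaughan1975Lemma43NonExceptional
import Literature.NumberTheory.LFunctions.MoebiusTwoPowerModuliProofs
import Literature.NumberTheory.LFunctions.DirichletLFunctionZeroFreeRegion
import Summits.ValiantsHypothesis.ValiantsHypothesis.Theorems.LiouvilleSarnakAlignedTypeICharactersMod2nBilinearSieveLambda
import HarnessLib

/-!
# Route LiouvilleSarnak — support `AlignedTypeI` (stmt-ValiantsHypothesis-21040), line `characters_mod_2n`:
# the Linnik–Gallagher range for `2`-power conductors is FREE (unconditional); only the top conductors remain

The bilinear-sieve chain (`…BilinearSieveLambda.lean`) closes the leaf `AlignedTypeI` from `ψ(t, χ)`-bounds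
`‖Σ_{n ≤ t} Λ(n) χ(n)‖ ≤ η t` for ALL primitive `χ (mod 2^j)`, `1 ≤ j ≤ k`, `t ≥ 2^{θ k}` (hypothesis `H_Λ` of
`alignedTypeI_of_vonMangoldtPrimeCharSums`); `…BilinearSieveLargeConductor.lean` discharged the BOUNDED conductors `j < J`
with Siegel–Walfisz.  Here we discharge, UNCONDITIONALLY, every conductor `2^j` with `j ≤ δ(θ, η) k` — i.e. all
`q = 2^j ≤ x^{δ'}` — using two theorems PROVED in the tree:

* Gallagher's prime number theorem (Invent. Math. 11 (1970), Thm 7, in the form of Montgomery–Vaughan 1975 Lemma 4.3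
  restricted to the non-exceptional characters): `Literature.NumberTheory.Sieve.MontgomeryVaughan1975.gallagher_nonexceptional`
  (truncated explicit formulae + Bombieri's log-free zero-density estimate, all proved in the tree);
* no exceptional zero for `2`-power moduli: real zeros of `L(s, χ)`, `χ ≠ χ₀ (mod 2^j)`, satisfy
  `β ≤ 1 − κ/log(4·2^j)` (`realZero_le_twoPower`, from the tree's MV Thm 11.3 `DirichletZFR.exists_zeroFree` for complex `χ`
  and Green's gap `MoebiusTwoPower.exists_realZero_le` for the quadratic ones, which factor through `8`).

Results (namespace `…Theorems.LiouvilleSarnak.AlignedTypeI.CharactersModTwoN`):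

* `logWeightedPrimeCharSum_le_linnikRange` — ★ for every `η > 0` there are `B ≥ 1`, `L₀ ≥ 1` with
  `‖Σ_{p ≤ t} (log p) χ(p)‖ ≤ η t` for every `j ≥ 1`, every primitive `χ (mod 2^j)` and every natural `t` with
  `log t ≥ L₀` and `log t ≥ B · j · log 2` (i.e. `t ≥ q^B`, `q = 2^j`): the LINNIK–GALLAGHER RANGE, unconditional;
* `vonMangoldtCharSum_le_linnikRange` — the same for `ψ(t, χ) = Σ_{n ≤ t} Λ(n) χ(n)`;

The leaf's currency (`δ k ≥ j` free, `H_Λ^top → AlignedTypeI`) is in `…BilinearSieveTopConductor.lean`.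

HONEST FRAMING. The new theorems are unconditional but do NOT close the leaf: `AlignedTypeI` remains open / closed only
modulo the cited Banks–Shparlinski fact; the residual is sharpened from "all large conductors" to "the conductors within a
power of `x`". Nothing here bears on `VP ≠ VNP` (NOT proved).
-/

set_option linter.dupNamespace false

noncomputable section

namespace Summit.ValiantsHypothesis.ValiantsHypothesis.Theorems.LiouvilleSarnak.AlignedTypeI.CharactersModTwoN

open Finset ArithmeticFunction
open scoped BigOperators
open Literature.NumberTheory.Sieve.MontgomeryVaughan1975 (IsExceptionalZero gallagherTerm charPrimeSum
  gallagher_nonexceptional)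

/-- **No exceptional zero for `2`-power moduli, quantitative form.** There is an absolute `κ > 0` such that every
real zero `β` of `L(s, χ)`, `χ ≠ χ₀ (mod 2^j)`, satisfies `β ≤ 1 − κ/(log 2^j + log 4)`: complex characters by the
classical zero-free region (MV Thm 11.3, tree `DirichletZFR.exists_zeroFree`), quadratic ones by Green's uniform gap
(tree `MoebiusTwoPower.exists_realZero_le`: they factor through `8`). [folklore] -/
theorem realZero_le_twoPower :
    ∃ κ : ℝ, 0 < κ ∧ ∀ (j : ℕ) (χ : DirichletCharacter ℂ (2 ^ j)), χ ≠ 1 → ∀ β : ℝ,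
      χ.LFunction β = 0 → β ≤ 1 - κ / (Real.log ((2 : ℝ) ^ j) + Real.log 4) := by
  obtain ⟨c, hc, hZ⟩ := Literature.NumberTheory.LFunctions.DirichletZFR.exists_zeroFree
  obtain ⟨δ, hδ, hR⟩ := Literature.NumberTheory.LFunctions.MoebiusTwoPower.exists_realZero_le
  refine ⟨min c δ, lt_min hc hδ, fun j χ hχ β hβ => ?_⟩
  haveI : NeZero (2 ^ j) := ⟨pow_ne_zero _ two_ne_zero⟩
  have hlog2j : 0 ≤ Real.log ((2 : ℝ) ^ j) := Real.log_nonneg (one_le_pow₀ (by norm_num))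
  have hlog4 : 1 ≤ Real.log 4 := by
    rw [← Real.log_exp 1]
    exact Real.log_le_log (Real.exp_pos 1) (by have := Real.exp_one_lt_d9; linarith)
  have hL1 : 1 ≤ Real.log ((2 : ℝ) ^ j) + Real.log 4 := by linarith
  have hL0 : 0 < Real.log ((2 : ℝ) ^ j) + Real.log 4 := by linarith
  have hcast : ((2 ^ j : ℕ) : ℝ) = (2 : ℝ) ^ j := by norm_num
  have hmin_c : min c δ / (Real.log ((2 : ℝ) ^ j) + Real.log 4) ≤ c / (Real.log ((2 : ℝ) ^ j) + Real.log 4) :=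
    div_le_div_of_nonneg_right (min_le_left _ _) hL0.le
  have hmin_δ : min c δ / (Real.log ((2 : ℝ) ^ j) + Real.log 4) ≤ δ / (Real.log ((2 : ℝ) ^ j) + Real.log 4) :=
    div_le_div_of_nonneg_right (min_le_right _ _) hL0.le
  have hδL : δ / (Real.log ((2 : ℝ) ^ j) + Real.log 4) ≤ δ := div_le_self hδ.le hL1
  by_cases hreg : 1 - c / (Real.log ((2 ^ j : ℕ) : ℝ) + Real.log (|(β : ℂ).im| + 4)) < (β : ℂ).re
  · -- inside the classical region: `χ` is quadratic, and then Green's gap applies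
    have hq : χ ^ 2 = 1 := (hZ (2 ^ j) χ hχ (β : ℂ) hβ hreg).1
    have hβδ : β ≤ 1 - δ := hR j χ hq hχ β hβ
    linarith
  · rw [not_lt, Complex.ofReal_re, Complex.ofReal_im, abs_zero, zero_add, hcast] at hreg
    linarith

/-- Arithmetic of the level: `log(4 · 2^j) = log 2^j + log 4 = (j + 2) log 2 ≤ 3 j log 2` for `j ≥ 1`. [folklore] -/
theorem log_four_mul_two_pow {j : ℕ} (hj : 1 ≤ j) :
    Real.log (4 * (2 : ℝ) ^ j) = Real.log ((2 : ℝ) ^ j) + Real.log 4 ∧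
      0 < Real.log (4 * (2 : ℝ) ^ j) ∧ Real.log (4 * (2 : ℝ) ^ j) ≤ 3 * j * Real.log 2 := by
  have hlog2 : 0 < Real.log 2 := Real.log_pos (by norm_num)
  have h1 : Real.log (4 * (2 : ℝ) ^ j) = Real.log ((2 : ℝ) ^ j) + Real.log 4 := by
    rw [mul_comm, Real.log_mul (by positivity) (by norm_num)]
  have h2 : Real.log ((2 : ℝ) ^ j) = j * Real.log 2 := by rw [Real.log_pow]
  have h4 : Real.log 4 = 2 * Real.log 2 := by
    rw [show (4 : ℝ) = 2 ^ 2 by norm_num, Real.log_pow]; norm_num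
  have hj' : (1 : ℝ) ≤ j := by exact_mod_cast hj
  refine ⟨h1, ?_, ?_⟩
  · rw [h1, h2, h4]; nlinarith
  · rw [h1, h2, h4]; nlinarith

/-- ★ **The Linnik–Gallagher range for `2`-power conductors, log-weighted prime sums (UNCONDITIONAL).** For every `η > 0`
there are `B ≥ 1` and `L₀ ≥ 1` such that `‖Σ_{p ≤ t} (log p) χ(p)‖ ≤ η t` for every `j ≥ 1`, every primitive
`χ (mod 2^j)` and every natural `t` with `log t ≥ L₀` and `log t ≥ B · j · log 2`.  Proof: Gallagher's theorem
(`gallagher_nonexceptional`) at `N = x = h = t`, level `P = exp(max(√log t, A log(4·2^j)))` with `A = c₁/κ + 1`; the term of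
`χ` is one non-negative term of the double sum, `χ` is never the exceptional character (`realZero_le_twoPower`: an
exceptional zero would have `β ≥ 1 − c₁/log P > 1 − κ/log(4·2^j)`), and the saving `exp(−c₁ log t/log P)` is `≤ η/(4C+1)`
in the stated range. [folklore] -/
theorem logWeightedPrimeCharSum_le_linnikRange :
    ∀ η : ℝ, 0 < η → ∃ B : ℝ, 1 ≤ B ∧ ∃ L₀ : ℝ, 1 ≤ L₀ ∧ ∀ j : ℕ, 1 ≤ j →
      ∀ χ : DirichletCharacter ℂ (2 ^ j), χ.IsPrimitive → ∀ t : ℕ,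
        L₀ ≤ Real.log t → B * j * Real.log 2 ≤ Real.log t →
          ‖∑ p ∈ (Finset.Iic t).filter Nat.Prime, (Real.log p : ℂ) * χ (p : ZMod (2 ^ j))‖ ≤ η * t := by
  obtain ⟨c₁, hc₁, c₄, hc₄, C, hG⟩ := gallagher_nonexceptional
  obtain ⟨κ, hκ, hreal⟩ := realZero_le_twoPower
  intro η hη
  have hlog2 : 0 < Real.log 2 := Real.log_pos (by norm_num)
  -- constants
  set C' : ℝ := max C 0 with hC'
  have hC'0 : 0 ≤ C' := le_max_right _ _
  have hCC' : C ≤ C' := le_max_left _ _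
  set Ls : ℝ := max (Real.log ((4 * C' + 1) / η)) 0 with hLs
  have hLs0 : 0 ≤ Ls := le_max_right _ _
  set A : ℝ := c₁ / κ + 1 with hA
  have hA1 : 1 ≤ A := by
    have : 0 ≤ c₁ / κ := by positivity
    linarith
  have hA0 : 0 < A := by linarith
  set B : ℝ := max (max (3 * A / c₄) (3 * A * Ls / c₁)) 1 with hB
  set L₀ : ℝ := max (max ((1 / c₄) ^ 2) ((Ls / c₁) ^ 2)) 1 with hL₀
  refine ⟨B, le_max_right _ _, L₀, le_max_right _ _, fun j hj χ hχ t hL₀t hBt => ?_⟩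
  haveI : NeZero (2 ^ j) := ⟨pow_ne_zero _ two_ne_zero⟩
  obtain ⟨hlog42, hlog42pos, hlog42le⟩ := log_four_mul_two_pow hj
  have hB1 : 3 * A / c₄ ≤ B := (le_max_left _ _).trans (le_max_left _ _)
  have hB2 : 3 * A * Ls / c₁ ≤ B := (le_max_right _ _).trans (le_max_left _ _)
  have hL₀1 : (1 / c₄) ^ 2 ≤ L₀ := (le_max_left _ _).trans (le_max_left _ _)
  have hL₀2 : (Ls / c₁) ^ 2 ≤ L₀ := (le_max_right _ _).trans (le_max_left _ _)
  have hL₀3 : (1 : ℝ) ≤ L₀ := le_max_right _ _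
  -- `t ≥ e > 2`
  set u : ℝ := Real.log t with hu
  have hu1 : 1 ≤ u := hL₀3.trans hL₀t
  have ht0 : (0 : ℝ) < t := by
    by_contra h
    have : (t : ℝ) = 0 := le_antisymm (not_lt.mp h) (Nat.cast_nonneg t)
    rw [hu, this, Real.log_zero] at hu1
    linarith
  have hte : Real.exp 1 ≤ t := by
    rw [← Real.exp_log ht0]; exact Real.exp_le_exp.mpr hu1
  have ht2R : (2 : ℝ) < t := lt_of_lt_of_le (by have := Real.exp_one_gt_d9; linarith) hte
  have ht2 : 2 ≤ t := by exact_mod_cast ht2R.le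
  have hjR : (1 : ℝ) ≤ j := by exact_mod_cast hj
  -- the level `P`
  set M : ℝ := max (Real.sqrt u) (A * Real.log (4 * (2 : ℝ) ^ j)) with hM
  have hAM : A * Real.log (4 * (2 : ℝ) ^ j) ≤ M := le_max_right _ _
  have hM0 : 0 < M := lt_of_lt_of_le (mul_pos hA0 hlog42pos) hAM
  set P : ℝ := Real.exp M with hP
  have hP0 : 0 < P := Real.exp_pos M
  have hPlog : Real.log P = M := Real.log_exp M
  have hP1 : Real.exp (Real.sqrt (Real.log t)) ≤ P := Real.exp_le_exp.mpr (le_max_left _ _)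
  have hPone : 1 ≤ P := by
    calc (1 : ℝ) = Real.exp 0 := (Real.exp_zero).symm
      _ ≤ P := Real.exp_le_exp.mpr hM0.le
  -- `√u ≥ 1/c₄` and `√u ≥ Ls/c₁`
  have hsq1 : 1 / c₄ ≤ Real.sqrt u := by
    rw [show 1 / c₄ = Real.sqrt ((1 / c₄) ^ 2) from (Real.sqrt_sq (by positivity)).symm]
    exact Real.sqrt_le_sqrt (hL₀1.trans hL₀t)
  have hsq2 : Ls / c₁ ≤ Real.sqrt u := by
    rw [show Ls / c₁ = Real.sqrt ((Ls / c₁) ^ 2) from (Real.sqrt_sq (by positivity)).symm]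
    exact Real.sqrt_le_sqrt (hL₀2.trans hL₀t)
  have hsqu : Real.sqrt u * Real.sqrt u = u := Real.mul_self_sqrt (by linarith)
  have hsq0 : 0 ≤ Real.sqrt u := Real.sqrt_nonneg u
  -- `P ≤ t^{c₄}`
  have hP2 : P ≤ (t : ℝ) ^ c₄ := by
    rw [Real.rpow_def_of_pos ht0, hP]
    refine Real.exp_le_exp.mpr (max_le ?_ ?_)
    · -- `√u ≤ c₄ u`
      have h1 : 1 ≤ c₄ * Real.sqrt u := by
        have := (div_le_iff₀ hc₄).mp hsq1; linarith
      calc Real.sqrt u = Real.sqrt u * 1 := (mul_one _).symm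
        _ ≤ Real.sqrt u * (c₄ * Real.sqrt u) := mul_le_mul_of_nonneg_left h1 hsq0
        _ = c₄ * (Real.sqrt u * Real.sqrt u) := by ring
        _ = Real.log t * c₄ := by rw [hsqu, hu, mul_comm]
    · -- `A log(4·2^j) ≤ 3 A j log 2 ≤ c₄ B j log 2 ≤ c₄ u`
      have h1 : A * Real.log (4 * (2 : ℝ) ^ j) ≤ A * (3 * j * Real.log 2) :=
        mul_le_mul_of_nonneg_left hlog42le hA0.le
      have h3A : 3 * A ≤ B * c₄ := (div_le_iff₀ hc₄).mp hB1
      calc A * Real.log (4 * (2 : ℝ) ^ j) ≤ A * (3 * j * Real.log 2) := h1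
        _ = (3 * A) * (j * Real.log 2) := by ring
        _ ≤ (B * c₄) * (j * Real.log 2) := mul_le_mul_of_nonneg_right h3A (by positivity)
        _ = c₄ * (B * j * Real.log 2) := by ring
        _ ≤ c₄ * u := mul_le_mul_of_nonneg_left hBt hc₄.le
        _ = Real.log t * c₄ := by rw [hu, mul_comm]
  -- the saving: `Ls ≤ c₁ u / M`
  have hLsM : Ls * M ≤ c₁ * u := by
    rcases le_total (Real.sqrt u) (A * Real.log (4 * (2 : ℝ) ^ j)) with h | h
    · rw [hM, max_eq_right h]
      have h1 : Ls * (A * Real.log (4 * (2 : ℝ) ^ j)) ≤ Ls * (A * (3 * j * Real.log 2)) :=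
        mul_le_mul_of_nonneg_left (mul_le_mul_of_nonneg_left hlog42le hA0.le) hLs0
      have h3A : 3 * A * Ls ≤ B * c₁ := (div_le_iff₀ hc₁).mp hB2
      calc Ls * (A * Real.log (4 * (2 : ℝ) ^ j)) ≤ Ls * (A * (3 * j * Real.log 2)) := h1
        _ = (3 * A * Ls) * (j * Real.log 2) := by ring
        _ ≤ (B * c₁) * (j * Real.log 2) := mul_le_mul_of_nonneg_right h3A (by positivity)
        _ = c₁ * (B * j * Real.log 2) := by ring
        _ ≤ c₁ * u := mul_le_mul_of_nonneg_left hBt hc₁.le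
    · rw [hM, max_eq_left h]
      have h1 : Ls ≤ c₁ * Real.sqrt u := by
        have := (div_le_iff₀ hc₁).mp hsq2; linarith
      calc Ls * Real.sqrt u ≤ (c₁ * Real.sqrt u) * Real.sqrt u := mul_le_mul_of_nonneg_right h1 hsq0
        _ = c₁ * u := by rw [mul_assoc, hsqu]
  have hE : Real.exp (-c₁ * Real.log t / Real.log P) ≤ η / (4 * C' + 1) := by
    have h1 : -c₁ * Real.log t / Real.log P ≤ -Ls := by
      rw [hPlog, neg_mul, neg_div, neg_le_neg_iff, le_div_iff₀ hM0]
      exact hLsM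
    have h2 : Real.log ((4 * C' + 1) / η) ≤ Ls := le_max_left _ _
    have h4C : 0 < (4 * C' + 1) / η := by positivity
    calc Real.exp (-c₁ * Real.log t / Real.log P) ≤ Real.exp (-Ls) := Real.exp_le_exp.mpr h1
      _ ≤ Real.exp (-Real.log ((4 * C' + 1) / η)) := Real.exp_le_exp.mpr (by linarith)
      _ = η / (4 * C' + 1) := by rw [Real.exp_neg, Real.exp_log h4C, inv_div]
  have hE0 : 0 ≤ Real.exp (-c₁ * Real.log t / Real.log P) := (Real.exp_pos _).le
  -- Gallagher's theorem at `N = x = h = t`, level `P`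
  have key := hG t P ht2 hP1 hP2 (fun _ _ => t) (fun _ _ => t) (fun _ _ => le_rfl) (fun _ _ => le_rfl)
  obtain ⟨hcase1, hcase2⟩ := key
  have hw0 : (0 : ℝ) < (t : ℝ) + t / P := add_pos_of_pos_of_nonneg ht0 (div_nonneg ht0.le hP0.le)
  have h2jP : ((2 ^ j : ℕ) : ℝ) ≤ P := by
    have h1 : ((2 ^ j : ℕ) : ℝ) ≤ 4 * (2 : ℝ) ^ j := by push_cast; linarith [pow_pos (show (0:ℝ) < 2 by norm_num) j]
    have h2 : 4 * (2 : ℝ) ^ j = Real.exp (Real.log (4 * (2 : ℝ) ^ j)) := (Real.exp_log (by positivity)).symm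
    have h3 : Real.log (4 * (2 : ℝ) ^ j) ≤ M := by
      calc Real.log (4 * (2 : ℝ) ^ j) = 1 * Real.log (4 * (2 : ℝ) ^ j) := (one_mul _).symm
        _ ≤ A * Real.log (4 * (2 : ℝ) ^ j) := mul_le_mul_of_nonneg_right hA1 hlog42pos.le
        _ ≤ M := hAM
    calc ((2 ^ j : ℕ) : ℝ) ≤ 4 * (2 : ℝ) ^ j := h1
      _ = Real.exp (Real.log (4 * (2 : ℝ) ^ j)) := h2
      _ ≤ P := Real.exp_le_exp.mpr h3
  have h2j : (2 ^ j : ℕ) ∈ Icc 1 ⌊P⌋₊ := by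
    rw [Finset.mem_Icc]; exact ⟨Nat.one_le_two_pow, Nat.le_floor h2jP⟩
  -- `χ` is never the exceptional character at level `(c₁, P)`
  have hnotexc : ∀ (χe : DirichletCharacter ℂ (2 ^ j)) (β : ℝ), IsExceptionalZero c₁ P (2 ^ j) χe β →
      ¬ (∀ n : ℕ, χ (n : ZMod (2 ^ j)) = χe (n : ZMod (2 ^ j))) := by
    intro χe β hexc hval
    obtain ⟨-, hne, -, hβ1, -, hzero⟩ := hexc
    have hχe : χe = χ := by
      refine MulChar.ext (fun a => ?_)
      have h := hval (a : ZMod (2 ^ j)).val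
      rw [ZMod.natCast_zmod_val] at h
      exact h.symm
    rw [hχe] at hne hzero
    have hb := hreal j χ hne β hzero
    -- `c₁/log P ≤ c₁/(A log(4·2^j)) < κ/log(4·2^j)`
    rw [← hlog42] at hb
    have h1 : c₁ / Real.log P ≤ c₁ / (A * Real.log (4 * (2 : ℝ) ^ j)) := by
      rw [hPlog]
      exact div_le_div_of_nonneg_left hc₁.le (mul_pos hA0 hlog42pos) hAM
    have h2 : c₁ / A < κ := by
      rw [div_lt_iff₀ hA0, hA]
      have : κ * (c₁ / κ + 1) = c₁ + κ := by field_simp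
      linarith
    have h3 : c₁ / (A * Real.log (4 * (2 : ℝ) ^ j)) < κ / Real.log (4 * (2 : ℝ) ^ j) := by
      rw [← div_div]
      apply lt_of_sub_pos
      rw [← sub_div]
      exact div_pos (by linarith) hlog42pos
    linarith
  -- the term of `χ` is bounded by the whole double sum
  have hT : ((t : ℝ) + t / P)⁻¹ * ‖gallagherTerm χ t t‖ ≤ C * Real.exp (-c₁ * Real.log t / Real.log P) := by
    rcases em (∀ (r : ℕ) [NeZero r] (χe : DirichletCharacter ℂ r) (β : ℝ), ¬ IsExceptionalZero c₁ P r χe β)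
      with hex | hex
    · have hS := hcase1 hex
      refine le_trans ?_ hS
      refine le_trans ?_ (Finset.single_le_sum (fun q _ => Finset.sum_nonneg fun χ' _ =>
        mul_nonneg (inv_nonneg.mpr hw0.le) (norm_nonneg _)) h2j)
      refine Finset.single_le_sum (f := fun χ' : DirichletCharacter ℂ (2 ^ j) =>
          ((t : ℝ) + t / P)⁻¹ * ‖gallagherTerm χ' t t‖)
        (fun χ' _ => mul_nonneg (inv_nonneg.mpr hw0.le) (norm_nonneg _)) ?_
      simp only [Finset.mem_filter, Finset.mem_univ, true_and]
      exact hχ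
    · push Not at hex
      obtain ⟨r, hr, χe, β, hexc⟩ := hex
      have hS := hcase2 r χe β hexc
      refine le_trans ?_ hS
      refine le_trans ?_ (Finset.single_le_sum (fun q _ => Finset.sum_nonneg fun χ' _ =>
        mul_nonneg (inv_nonneg.mpr hw0.le) (norm_nonneg _)) h2j)
      refine Finset.single_le_sum (f := fun χ' : DirichletCharacter ℂ (2 ^ j) =>
          ((t : ℝ) + t / P)⁻¹ * ‖gallagherTerm χ' t t‖)
        (fun χ' _ => mul_nonneg (inv_nonneg.mpr hw0.le) (norm_nonneg _)) ?_
      simp only [Finset.mem_filter, Finset.mem_univ, true_and]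
      refine ⟨hχ, ?_⟩
      rintro ⟨hrj, hval⟩
      subst hrj
      exact hnotexc χe β hexc hval
  -- unpack: `‖θ(t, χ)‖ ≤ (t + t/P) C e^{−c₁ u/log P} ≤ 2 t C' η/(4C'+1) ≤ η t`
  have h2j1 : (2 ^ j : ℕ) ≠ 1 := by
    have : 2 ≤ 2 ^ j := by
      calc 2 = 2 ^ 1 := by norm_num
        _ ≤ 2 ^ j := Nat.pow_le_pow_right (by norm_num) hj
    omega
  have hterm : gallagherTerm χ t t = ∑ p ∈ (Finset.Iic t).filter Nat.Prime, (Real.log p : ℂ) * χ (p : ZMod (2 ^ j)) := by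
    rw [gallagherTerm, if_neg h2j1, sub_zero, charPrimeSum, Nat.sub_self, ← Iic_filter_prime_eq_Ioc_filter_prime]
    exact Finset.sum_congr rfl fun p _ => mul_comm _ _
  rw [← hterm]
  have h1 : ‖gallagherTerm χ t t‖ ≤ ((t : ℝ) + t / P) * (C * Real.exp (-c₁ * Real.log t / Real.log P)) :=
    (inv_mul_le_iff₀ hw0).mp hT
  have h1' : ‖gallagherTerm χ t t‖ ≤ ((t : ℝ) + t / P) * (C' * Real.exp (-c₁ * Real.log t / Real.log P)) :=
    h1.trans (mul_le_mul_of_nonneg_left (mul_le_mul_of_nonneg_right hCC' hE0) hw0.le)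
  have h2 : ((t : ℝ) + t / P) ≤ 2 * t := by
    have : (t : ℝ) / P ≤ t := div_le_self ht0.le hPone
    linarith
  have h3 : C' * Real.exp (-c₁ * Real.log t / Real.log P) ≤ C' * (η / (4 * C' + 1)) :=
    mul_le_mul_of_nonneg_left hE hC'0
  have h4 : 2 * C' * (η / (4 * C' + 1)) ≤ η := by
    have h5 : 0 < 4 * C' + 1 := by positivity
    have h6 : 2 * C' / (4 * C' + 1) ≤ 1 := by rw [div_le_one h5]; linarith
    calc 2 * C' * (η / (4 * C' + 1)) = η * (2 * C' / (4 * C' + 1)) := by ring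
      _ ≤ η * 1 := mul_le_mul_of_nonneg_left h6 hη.le
      _ = η := mul_one η
  calc ‖gallagherTerm χ t t‖ ≤ ((t : ℝ) + t / P) * (C' * Real.exp (-c₁ * Real.log t / Real.log P)) := h1'
    _ ≤ (2 * t) * (C' * (η / (4 * C' + 1))) := mul_le_mul h2 h3 (mul_nonneg hC'0 hE0) (by positivity)
    _ = (2 * C' * (η / (4 * C' + 1))) * t := by ring
    _ ≤ η * t := mul_le_mul_of_nonneg_right h4 ht0.le

/-- ★ **The Linnik–Gallagher range for `2`-power conductors, `ψ(t, χ)` form (UNCONDITIONAL).** For every `η > 0` there are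
`B ≥ 1`, `L₀ ≥ 1` with `‖Σ_{n ≤ t} Λ(n) χ(n)‖ ≤ η t` for every `j ≥ 1`, primitive `χ (mod 2^j)` and natural `t` with
`log t ≥ L₀`, `log t ≥ B · j · log 2` (prime powers cost `2√t log t`, `norm_sum_vonMangoldt_sub_logWeighted_le`). [folklore] -/
theorem vonMangoldtCharSum_le_linnikRange :
    ∀ η : ℝ, 0 < η → ∃ B : ℝ, 1 ≤ B ∧ ∃ L₀ : ℝ, 1 ≤ L₀ ∧ ∀ j : ℕ, 1 ≤ j →
      ∀ χ : DirichletCharacter ℂ (2 ^ j), χ.IsPrimitive → ∀ t : ℕ,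
        L₀ ≤ Real.log t → B * j * Real.log 2 ≤ Real.log t →
          ‖∑ n ∈ Finset.Ioc 0 t, ((vonMangoldt n : ℝ) : ℂ) * χ (n : ZMod (2 ^ j))‖ ≤ η * t := by
  intro η hη
  obtain ⟨B, hB1, L₁, hL₁1, hmain⟩ := logWeightedPrimeCharSum_le_linnikRange (η / 2) (by positivity)
  set L₀ : ℝ := max L₁ (4 * Real.log (16 / η)) with hL₀
  refine ⟨B, hB1, L₀, hL₁1.trans (le_max_left _ _), fun j hj χ hχ t hL₀t hBt => ?_⟩
  have hL₁t : L₁ ≤ Real.log t := (le_max_left _ _).trans hL₀t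
  have h16 : 4 * Real.log (16 / η) ≤ Real.log t := (le_max_right _ _).trans hL₀t
  have hθ := hmain j hj χ hχ t hL₁t hBt
  have hu1 : 1 ≤ Real.log t := hL₁1.trans hL₁t
  have ht0 : (0 : ℝ) < t := by
    by_contra h
    have : (t : ℝ) = 0 := le_antisymm (not_lt.mp h) (Nat.cast_nonneg t)
    rw [this, Real.log_zero] at hu1
    linarith
  have ht1 : 1 ≤ t := by exact_mod_cast (show 0 < t by exact_mod_cast ht0)
  have hdiff := norm_sum_vonMangoldt_sub_logWeighted_le (fun n => χ (n : ZMod (2 ^ j)))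
    (fun n => χ.norm_le_one _) t ht1
  -- `√√t ≥ 16/η` from `log t ≥ 4 log(16/η)`
  have hw : 16 / η ≤ Real.sqrt (Real.sqrt t) := by
    have h16' : 0 < 16 / η := by positivity
    have hpow : (16 / η) ^ 4 ≤ (t : ℝ) := by
      have h1 : Real.log ((16 / η) ^ 4) ≤ Real.log t := by rw [Real.log_pow]; push_cast; linarith
      exact (Real.log_le_log_iff (by positivity) ht0).mp h1
    have hs0 : 0 ≤ Real.sqrt (Real.sqrt (t : ℝ)) := Real.sqrt_nonneg _
    have hs4 : Real.sqrt (Real.sqrt (t : ℝ)) ^ 4 = (t : ℝ) := by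
      have h2 : Real.sqrt (Real.sqrt (t : ℝ)) ^ 2 = Real.sqrt (t : ℝ) := Real.sq_sqrt (Real.sqrt_nonneg _)
      calc Real.sqrt (Real.sqrt (t : ℝ)) ^ 4 = (Real.sqrt (Real.sqrt (t : ℝ)) ^ 2) ^ 2 := by ring
        _ = (t : ℝ) := by rw [h2, Real.sq_sqrt ht0.le]
    by_contra hlt
    rw [not_le] at hlt
    have : Real.sqrt (Real.sqrt (t : ℝ)) ^ 4 < (16 / η) ^ 4 := pow_lt_pow_left₀ hlt hs0 (by norm_num)
    linarith
  have herr := two_sqrt_mul_log_le ht0 hη hw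
  calc ‖∑ n ∈ Finset.Ioc 0 t, ((vonMangoldt n : ℝ) : ℂ) * χ (n : ZMod (2 ^ j))‖
      ≤ ‖∑ p ∈ (Finset.Iic t).filter Nat.Prime, (Real.log p : ℂ) * χ (p : ZMod (2 ^ j))‖ +
          ‖∑ n ∈ Finset.Ioc 0 t, ((vonMangoldt n : ℝ) : ℂ) * χ (n : ZMod (2 ^ j)) -
            ∑ p ∈ (Finset.Iic t).filter Nat.Prime, (Real.log p : ℂ) * χ (p : ZMod (2 ^ j))‖ :=
        norm_le_norm_add_norm_sub' _ _
    _ ≤ η / 2 * t + 2 * Real.sqrt t * Real.log t := add_le_add hθ hdiff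
    _ ≤ η / 2 * t + η * t / 2 := by linarith
    _ = η * t := by ring

end Summit.ValiantsHypothesis.ValiantsHypothesis.Theorems.LiouvilleSarnak.AlignedTypeI.CharactersModTwoN
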